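import Summits.Ventures.YMGap.RobustBall.StarKernelClusteringBall
import Summits.Ventures.YMGap.RobustBall.UniformLoopCorrelatorDecay
import HarnessLib

/-!
# Venture YMGap, track DS / Y2 ROBUST-BALL (seat ds-3) — «C-KMIX-STAR» Wilson-LOOP cells on the gauge-invariant tier-1 `ℤ⁴` ball: the loop–loop
# correlator of the member's finite volume with ANY boundary field and the boundary-field independence of Wilson-loop expectations,
# `SU(2)`, `d = 4`, every `0 ≤ β_W ≤ 1/3`, every member of `MemBallZdG (3/125) (3/250) R`

HONEST FRAMING. WHAT THIS IS: a venture file (cell `pub-ymgap`, seat ds-3; theorems only, no `def`, no named fact): the Wilson-loop specialisations of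
`StarKernelClusteringBall.su2_kernel_covariance_decay_star_ball_upTo_oneThird` / `su2_boundary_decay_star_ball_upTo_oneThird` (ds-2's ROBUST star door,
locality radius `max R 1 + 2`, certified received sum `ρ⋆`), with `W_γ = loopTerm 2 1 γ` a Lipschitz cylinder of constant `√2|γ|` on `≤ |γ|` links:
* `su2_kernel_loop_clustering_star_ball_upTo_oneThird` — `|cov_{γ^W_{Λ₀}(·|η)}(W_{γ₁}, W_{γ₂})| ≤ 32|γ₁|²|γ₂|² · ρ⋆^{min(⌊d(γ₁,γ₂)/E⌋, ⌊m/E⌋)}`, `E = max R 1 + 4`;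
* `su2_loop_boundary_decay_star_ball_upTo_oneThird` — `|⟨W_γ⟩_{γ^W_{Λ₀}(·|η)} − ⟨W_γ⟩_μ| ≤ 4|γ|² · ρ⋆^{⌊m/E⌋}` for every DLR state `μ` of the member.
WHAT THIS IS NOT: interior form; strong-coupling LATTICE statements; nothing about the area law, the continuum limit or the Clay problem.

References: the seat's `StarKernelClusteringBall.lean`, `StarLoopCellsZd.lean` (the Wilson-action twins at `β_W ≤ 9/25`); rb-p1's
`UniformLoopCorrelatorDecay.lean`.
-/

noncomputable section

open MeasureTheory ProbabilityTheory Function Finset Real SimpleGraph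
open scoped NNReal
open Literature.Probability.LatticeModels
open Literature.MathematicalPhysics.QuantumLattice hiding torusNorm
open Literature.MathematicalPhysics.QuantumFieldTheory hiding ZdEdge Site
open Literature.MathematicalPhysics.QuantumFieldTheory (walkEdges card_walkEdges_le_length)
open Summit.Ventures.YMGap.DSWindowZd
open Summit.Ventures.YMGap.StarResolventDim (gaugeR)

namespace Summit.Ventures.YMGap.RobustBall

/-- **THE LOOP–LOOP CORRELATOR OF THE MEMBER'S FINITE VOLUME WITH ANY BOUNDARY FIELD** (`SU(2)`, `d = 4`, `0 ≤ β_W ≤ 1/3`, every member of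
`MemBallZdG (3/125) (3/250) R`): for every finite `Λ₀`, EVERY `η`, every depth function `φ` and closed walks `γ₁` (links in `Λ₀` at depth `≥ m`), `γ₂`:
`|cov_{γ^W_{Λ₀}(·|η)}(W_{γ₁}, W_{γ₂})| ≤ 32|γ₁|²|γ₂|² · ρ⋆^{min(⌊d(γ₁,γ₂)/(max R 1 + 4)⌋, ⌊m/(max R 1 + 4)⌋)}`. [folklore] -/
theorem su2_kernel_loop_clustering_star_ball_upTo_oneThird {βW : ℝ} (h0 : 0 ≤ βW) (h : βW ≤ 1 / 3) {R : ℕ}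
    {W : Potential (ZdEdge 4) (SUN 2)} {supp : Finset (ZdEdge 4) → Finset (Finset (ZdEdge 4))}
    (hW : MemBallZdG (3 / 125) (3 / 250) R W supp)
    (Λ₀ : Finset (ZdEdge 4)) (η : LGConfig 4 (SUN 2)) (φ : ZdEdge 4 → ℝ)
    (hφ : ∀ x y : ZdEdge 4, φ x ≤ φ y + ‖x.1 - y.1‖) (hφΛ : ∀ x, 0 < φ x → x ∈ Λ₀)
    {x₁ x₂ : Literature.Probability.LatticeModels.Site 4} (w₁ : (zdGraph 4).Walk x₁ x₁) (w₂ : (zdGraph 4).Walk x₂ x₂)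
    (hΛ₁ : walkEdges w₁ ⊆ Λ₀) {m : ℝ} (hm : ∀ x ∈ walkEdges w₁, m ≤ φ x) :
    |cov[loopTerm 2 1 w₁, loopTerm 2 1 w₂; perturbedYM (d := 4) (fundamentalRep (Fin 2)) ((2 : ℕ) * (βW / 4)) W supp Λ₀ η]| ≤
      32 * (w₁.length : ℝ) ^ 2 * (w₂.length : ℝ) ^ 2 *
        (gaugeR 4 (17651 / 200000 : ℝ) + ((16971 / 1000000 : ℝ) +
            (6 * (17651 / 200000 : ℝ) + 16971 / 1000000) ^ 20 * (16 * (16971 / 1000000 : ℝ))) /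
            (1 - (6 * (17651 / 200000 : ℝ) + 16971 / 1000000))) ^
          (min (⌊setDistEdges (walkEdges w₁) (walkEdges w₂) / (max R 1 + 2 + 2 : ℕ)⌋₊) (⌊m / (max R 1 + 2 + 2 : ℕ)⌋₊)) := by
  have key := su2_kernel_covariance_decay_star_ball_upTo_oneThird h0 h hW Λ₀ η φ hφ hφΛ (isLipschitzCylinder_loopTerm (N := 2) 1 w₁)
    (isLipschitzCylinder_loopTerm (N := 2) 1 w₂) hΛ₁ hm
  refine key.trans ?_
  clear key
  have hc₁ : ((walkEdges w₁).card : ℝ) ≤ w₁.length := by exact_mod_cast card_walkEdges_le_length w₁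
  have hc₂ : ((walkEdges w₂).card : ℝ) ≤ w₂.length := by exact_mod_cast card_walkEdges_le_length w₂
  have h2 : Real.sqrt ((2 : ℕ) : ℝ) * Real.sqrt ((2 : ℕ) : ℝ) = 2 := Real.mul_self_sqrt (by norm_num)
  have hρ0 : (0 : ℝ) ≤ gaugeR 4 (17651 / 200000 : ℝ) + ((16971 / 1000000 : ℝ) +
      (6 * (17651 / 200000 : ℝ) + 16971 / 1000000) ^ 20 * (16 * (16971 / 1000000 : ℝ))) /
      (1 - (6 * (17651 / 200000 : ℝ) + 16971 / 1000000)) := by unfold gaugeR StarResolventDim.Delta; norm_num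
  set E := (gaugeR 4 (17651 / 200000 : ℝ) + ((16971 / 1000000 : ℝ) +
      (6 * (17651 / 200000 : ℝ) + 16971 / 1000000) ^ 20 * (16 * (16971 / 1000000 : ℝ))) /
      (1 - (6 * (17651 / 200000 : ℝ) + 16971 / 1000000))) ^
    (min (⌊setDistEdges (walkEdges w₁) (walkEdges w₂) / (max R 1 + 2 + 2 : ℕ)⌋₊) (⌊m / (max R 1 + 2 + 2 : ℕ)⌋₊))
  have hE : 0 ≤ E := pow_nonneg hρ0 _
  simp only [abs_one, one_mul]
  calc 16 * ((walkEdges w₁).card : ℝ) * ((walkEdges w₂).card : ℝ) *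
        (Real.sqrt ((2 : ℕ) : ℝ) * (w₁.length : ℝ) * (Real.sqrt ((2 : ℕ) : ℝ) * (w₂.length : ℝ))) * E
      = 16 * (Real.sqrt ((2 : ℕ) : ℝ) * Real.sqrt ((2 : ℕ) : ℝ)) *
          (((walkEdges w₁).card : ℝ) * w₁.length) * (((walkEdges w₂).card : ℝ) * w₂.length) * E := by ring
    _ ≤ 16 * (Real.sqrt ((2 : ℕ) : ℝ) * Real.sqrt ((2 : ℕ) : ℝ)) *
          ((w₁.length : ℝ) * w₁.length) * ((w₂.length : ℝ) * w₂.length) * E := by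
        have h₁ : ((walkEdges w₁).card : ℝ) * w₁.length ≤ (w₁.length : ℝ) * w₁.length :=
          mul_le_mul_of_nonneg_right hc₁ (Nat.cast_nonneg _)
        have h₂ : ((walkEdges w₂).card : ℝ) * w₂.length ≤ (w₂.length : ℝ) * w₂.length :=
          mul_le_mul_of_nonneg_right hc₂ (Nat.cast_nonneg _)
        have hs : 0 ≤ 16 * (Real.sqrt ((2 : ℕ) : ℝ) * Real.sqrt ((2 : ℕ) : ℝ)) := by positivity
        exact mul_le_mul_of_nonneg_right (mul_le_mul (mul_le_mul_of_nonneg_left h₁ hs) h₂ (by positivity) (by positivity)) hE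
    _ = 32 * (w₁.length : ℝ) ^ 2 * (w₂.length : ℝ) ^ 2 * E := by rw [h2]; ring

/-- **WILSON-LOOP EXPECTATIONS OF THE MEMBER FORGET THE BOUNDARY FIELD** (`SU(2)`, `d = 4`, `0 ≤ β_W ≤ 1/3`, every member of
`MemBallZdG (3/125) (3/250) R`, every DLR state `μ` of the member): for every finite `Λ₀`, EVERY `η`, every depth function `φ` and every closed walk `γ`
with links in `Λ₀` at depth `≥ m`: `|∫W_γ dγ^W_{Λ₀}(·|η) − ∫W_γ dμ| ≤ 4|γ|² · ρ⋆^{⌊m/(max R 1 + 4)⌋}`. [folklore] -/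
theorem su2_loop_boundary_decay_star_ball_upTo_oneThird {βW : ℝ} (h0 : 0 ≤ βW) (h : βW ≤ 1 / 3) {R : ℕ}
    {W : Potential (ZdEdge 4) (SUN 2)} {supp : Finset (ZdEdge 4) → Finset (Finset (ZdEdge 4))}
    (hW : MemBallZdG (3 / 125) (3 / 250) R W supp)
    {μ : Measure (LGConfig 4 (SUN 2))}
    (hμ : μ ∈ perturbedGibbsMeasures (d := 4) (fundamentalRep (Fin 2)) ((2 : ℕ) * (βW / 4)) W supp)
    (Λ₀ : Finset (ZdEdge 4)) (η : LGConfig 4 (SUN 2)) (φ : ZdEdge 4 → ℝ)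
    (hφ : ∀ x y : ZdEdge 4, φ x ≤ φ y + ‖x.1 - y.1‖) (hφΛ : ∀ x, 0 < φ x → x ∈ Λ₀)
    {x₀ : Literature.Probability.LatticeModels.Site 4} (w : (zdGraph 4).Walk x₀ x₀)
    (hΔ : walkEdges w ⊆ Λ₀) {m : ℝ} (hm : ∀ x ∈ walkEdges w, m ≤ φ x) :
    |(∫ U, loopTerm 2 1 w U ∂(perturbedYM (d := 4) (fundamentalRep (Fin 2)) ((2 : ℕ) * (βW / 4)) W supp Λ₀ η)) -
        ∫ U, loopTerm 2 1 w U ∂μ| ≤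
      4 * (w.length : ℝ) ^ 2 *
        (gaugeR 4 (17651 / 200000 : ℝ) + ((16971 / 1000000 : ℝ) +
            (6 * (17651 / 200000 : ℝ) + 16971 / 1000000) ^ 20 * (16 * (16971 / 1000000 : ℝ))) /
            (1 - (6 * (17651 / 200000 : ℝ) + 16971 / 1000000))) ^ ⌊m / (max R 1 + 2 + 2 : ℕ)⌋₊ := by
  have key := su2_boundary_decay_star_ball_upTo_oneThird h0 h hW hμ Λ₀ η φ hφ hφΛ (isLipschitzCylinder_loopTerm (N := 2) 1 w) hΔ hm
  refine key.trans ?_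
  clear key
  have hc : ((walkEdges w).card : ℝ) ≤ w.length := by exact_mod_cast card_walkEdges_le_length w
  have h2 : Real.sqrt 2 * Real.sqrt ((2 : ℕ) : ℝ) = 2 := by
    rw [show ((2 : ℕ) : ℝ) = 2 by norm_num]; exact Real.mul_self_sqrt (by norm_num)
  have hρ0 : (0 : ℝ) ≤ gaugeR 4 (17651 / 200000 : ℝ) + ((16971 / 1000000 : ℝ) +
      (6 * (17651 / 200000 : ℝ) + 16971 / 1000000) ^ 20 * (16 * (16971 / 1000000 : ℝ))) /
      (1 - (6 * (17651 / 200000 : ℝ) + 16971 / 1000000)) := by unfold gaugeR StarResolventDim.Delta; norm_num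
  set E := (gaugeR 4 (17651 / 200000 : ℝ) + ((16971 / 1000000 : ℝ) +
      (6 * (17651 / 200000 : ℝ) + 16971 / 1000000) ^ 20 * (16 * (16971 / 1000000 : ℝ))) /
      (1 - (6 * (17651 / 200000 : ℝ) + 16971 / 1000000))) ^ ⌊m / (max R 1 + 2 + 2 : ℕ)⌋₊
  have hE : 0 ≤ E := pow_nonneg hρ0 _
  simp only [abs_one, one_mul]
  calc 2 * Real.sqrt 2 * (Real.sqrt ((2 : ℕ) : ℝ) * (w.length : ℝ)) * ((walkEdges w).card : ℝ) * E
      = 2 * (Real.sqrt 2 * Real.sqrt ((2 : ℕ) : ℝ)) * ((w.length : ℝ) * (walkEdges w).card) * E := by ring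
    _ ≤ 2 * (Real.sqrt 2 * Real.sqrt ((2 : ℕ) : ℝ)) * ((w.length : ℝ) * w.length) * E := by
        have h₁ : (w.length : ℝ) * (walkEdges w).card ≤ (w.length : ℝ) * w.length :=
          mul_le_mul_of_nonneg_left hc (Nat.cast_nonneg _)
        have hs : 0 ≤ 2 * (Real.sqrt 2 * Real.sqrt ((2 : ℕ) : ℝ)) := by positivity
        exact mul_le_mul_of_nonneg_right (mul_le_mul_of_nonneg_left h₁ hs) hE
    _ = 4 * (w.length : ℝ) ^ 2 * E := by rw [h2]; ring

end Summit.Ventures.YMGap.RobustBall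

end
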